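import Summits.RiemannHypothesis.RiemannHypothesis.Theorems.EtaLeadingQuarterWeakLockingLayerEngine

/-!
# Log-scale Gaussian layers, II: the Gaussian main term (route EtaLeadingQuarter, item
`WeakLockingLayer`, stmt-RiemannHypothesis-21792)

Continuation of `EtaLeadingQuarterWeakLockingLayerEngine.lean`: the main term
`∫_1^M G(log x) dx = ∫_{−n}^{log M − n} Q(v) dv` of the first-order Euler–Maclaurin comparison is a
truncated complex Gaussian integral (`Q(v) = exp(−v²/(2s²) + (1+iγ)v + (1+iγ)n)`), evaluated over
`ℝ` by Mathlib's `integral_cexp_quadratic` with the two tails bounded elementarily; the section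
`Assembly` combines everything into the two-sided estimate for `∑_{m=2}^{M} g(log m − n) m^{iγ}`
(upper bound for every real `γ`, lower bound at `γ = 0`). All proved, RH-free.
Nothing here bears on the truth of RH.
-/

noncomputable section

open Complex MeasureTheory Set Filter Finset intervalIntegral
open scoped Real Topology

set_option linter.dupNamespace false  -- the mandated namespace repeats `RiemannHypothesis`

namespace Summit.RiemannHypothesis.RiemannHypothesis.Theorems.EtaLeadingQuarter.LockingEngine

/-! ## The main term: a truncated complex Gaussian integral -/

/-- The quadratic-exponential integrand `Q(v) = exp(b v² + c v + d)` with `b = −1/(2s²)`,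
`c = 1 + iγ`, `d = c n`, for which `e^u G(u) = Q(u − n)`. [folklore] -/
def quadExp (s n γ v : ℝ) : ℂ :=
  cexp (((-(1 / (2 * s ^ 2)) : ℝ) : ℂ) * (v : ℂ) ^ 2 + (1 + (γ : ℂ) * I) * v + (1 + (γ : ℂ) * I) * n)

/-- `e^u G(u) = Q(u − n)`. [folklore] -/
theorem exp_mul_gaussPhase (s n γ u : ℝ) :
    ((Real.exp u : ℝ) : ℂ) * gaussPhase s n γ u = quadExp s n γ (u - n) := by
  rw [Complex.ofReal_exp, gaussPhase, ← Complex.exp_add, quadExp, phaseExp]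
  congr 1
  push_cast
  ring

/-- The main term after the substitution `u = log x`:
`∫_1^M G(log x) dx = ∫_{−n}^{log M − n} Q(v) dv` (`M ≥ 1`). [folklore] -/
theorem integral_gaussPhase_log_eq (s n γ : ℝ) {M : ℝ} (hM : 1 ≤ M) :
    ∫ x in (1 : ℝ)..M, gaussPhase s n γ (Real.log x) =
      ∫ v in (-n)..(Real.log M - n), quadExp s n γ v := by
  have hIcc : uIcc (1 : ℝ) M = Icc 1 M := uIcc_of_le hM
  have h1 : ∫ x in (1 : ℝ)..M, gaussPhase s n γ (Real.log x) =
      ∫ x in (1 : ℝ)..M, x⁻¹ • ((fun u ↦ ((Real.exp u : ℝ) : ℂ) * gaussPhase s n γ u) ∘ Real.log) x := by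
    refine intervalIntegral.integral_congr fun x hx ↦ ?_
    rw [hIcc] at hx
    have hx0 : 0 < x := by linarith [hx.1]
    simp only [Function.comp_apply, Real.exp_log hx0, Complex.real_smul]
    rw [← mul_assoc, ← Complex.ofReal_mul, inv_mul_cancel₀ hx0.ne', Complex.ofReal_one, one_mul]
  rw [h1, intervalIntegral.integral_deriv_smul_comp' (f := Real.log) (f' := fun x ↦ x⁻¹)]
  · rw [Real.log_one]
    simp_rw [exp_mul_gaussPhase]
    rw [intervalIntegral.integral_comp_sub_right (fun v ↦ quadExp s n γ v) n, zero_sub]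
  · intro x hx
    rw [hIcc] at hx
    exact Real.hasDerivAt_log (by linarith [hx.1])
  · rw [hIcc]
    exact continuousOn_inv₀.mono fun x hx ↦ by
      rw [mem_compl_iff, mem_singleton_iff]; exact (by linarith [hx.1] : (0 : ℝ) < x).ne'
  · exact ((Complex.continuous_ofReal.comp Real.continuous_exp).mul
      (continuous_gaussPhase s n γ)).continuousOn

/-- `Q` is integrable on `ℝ` (`s ≠ 0`). [folklore] -/
theorem integrable_quadExp {s : ℝ} (hs : 0 < s) (n γ : ℝ) : Integrable (quadExp s n γ) := by
  unfold quadExp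
  refine integrable_cexp_quadratic' ?_ _ _
  rw [Complex.ofReal_re]
  have : 0 < 1 / (2 * s ^ 2) := by positivity
  linarith

/-- `‖Q(v)‖ = exp(n + v − v²/(2s²))`. [folklore] -/
theorem norm_quadExp (s n γ v : ℝ) :
    ‖quadExp s n γ v‖ = Real.exp (n + v - v ^ 2 / (2 * s ^ 2)) := by
  rw [quadExp, Complex.norm_exp]
  congr 1
  simp only [Complex.add_re, Complex.mul_re, Complex.ofReal_re, Complex.ofReal_im, Complex.one_re,
    Complex.I_re, Complex.I_im, ← Complex.ofReal_pow]
  ring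

/-- **The full Gaussian integral**: `‖∫_ℝ Q‖ = √(2π s²) · exp(n + (1 − γ²)s²/2)`. [folklore] -/
theorem norm_integral_quadExp {s : ℝ} (hs : 0 < s) (n γ : ℝ) :
    ‖∫ v, quadExp s n γ v‖ = Real.sqrt (2 * π * s ^ 2) * Real.exp (n + (1 - γ ^ 2) * s ^ 2 / 2) := by
  have hs2 : (0 : ℝ) < 2 * s ^ 2 := by positivity
  set B : ℂ := ((-(1 / (2 * s ^ 2)) : ℝ) : ℂ) with hB
  set C : ℂ := 1 + (γ : ℂ) * I with hC
  have hBre : B.re < 0 := by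
    rw [hB, Complex.ofReal_re]; have : 0 < 1 / (2 * s ^ 2) := by positivity
    linarith
  have hB0 : B ≠ 0 := fun h ↦ by rw [h, Complex.zero_re] at hBre; exact lt_irrefl _ hBre
  have hint : ∫ v, quadExp s n γ v = (↑π / -B) ^ (1 / 2 : ℂ) * cexp (C * n - C ^ 2 / (4 * B)) := by
    unfold quadExp
    exact integral_cexp_quadratic hBre C (C * n)
  rw [hint, norm_mul, Complex.norm_exp]
  -- the square root
  have h1 : (↑π / -B : ℂ) = ((2 * π * s ^ 2 : ℝ) : ℂ) := by
    rw [hB]; push_cast; field_simp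
  have h2 : ‖(↑π / -B : ℂ) ^ (1 / 2 : ℂ)‖ = Real.sqrt (2 * π * s ^ 2) := by
    rw [h1, Complex.norm_cpow_eq_rpow_re_of_pos (by positivity), Real.sqrt_eq_rpow]
    norm_num
  -- the exponent
  have h3 : C * n - C ^ 2 / (4 * B) = C * n + C ^ 2 * ((s ^ 2 / 2 : ℝ) : ℂ) := by
    rw [hB]
    have hs' : (s : ℂ) ≠ 0 := Complex.ofReal_ne_zero.2 hs.ne'
    push_cast
    field_simp
    ring
  have h4 : (C * n + C ^ 2 * ((s ^ 2 / 2 : ℝ) : ℂ)).re = n + (1 - γ ^ 2) * s ^ 2 / 2 := by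
    rw [hC]
    simp only [Complex.add_re, Complex.mul_re, Complex.ofReal_re, Complex.ofReal_im, Complex.one_re,
      Complex.one_im, Complex.I_re, Complex.I_im, sq, Complex.mul_im, Complex.add_im]
    ring
  rw [h2, h3, h4]

/-- **Upper tail**: for `U ≥ 2s²`, `‖∫_{v > U} Q‖ ≤ exp(n + U − U²/(2s²))`
(`v − v²/(2s²) ≤ U − U²/(2s²) − (v − U)` for `v ≥ U ≥ 2s²`). [folklore] -/
theorem norm_integral_quadExp_Ioi_le {s : ℝ} (hs : 0 < s) (n γ : ℝ) {U : ℝ} (hU : 2 * s ^ 2 ≤ U) :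
    ‖∫ v in Ioi U, quadExp s n γ v‖ ≤ Real.exp (n + U - U ^ 2 / (2 * s ^ 2)) := by
  have hs2 : (0 : ℝ) < 2 * s ^ 2 := by positivity
  set A : ℝ := n + 2 * U - U ^ 2 / (2 * s ^ 2) with hA
  have hdom : ∀ v ∈ Ioi U, ‖quadExp s n γ v‖ ≤ Real.exp A * Real.exp (-v) := by
    intro v hv
    rw [norm_quadExp, ← Real.exp_add, Real.exp_le_exp, hA]
    have hv' : U ≤ v := le_of_lt hv
    -- `2v - v²/(2s²) ≤ 2U - U²/(2s²)`
    have key : 2 * v - v ^ 2 / (2 * s ^ 2) ≤ 2 * U - U ^ 2 / (2 * s ^ 2) := by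
      rw [show 2 * v - v ^ 2 / (2 * s ^ 2) = (2 * v * (2 * s ^ 2) - v ^ 2) / (2 * s ^ 2) by
        field_simp, show 2 * U - U ^ 2 / (2 * s ^ 2) = (2 * U * (2 * s ^ 2) - U ^ 2) / (2 * s ^ 2) by
        field_simp]
      refine div_le_div_of_nonneg_right ?_ hs2.le
      nlinarith [mul_nonneg (sub_nonneg.2 hv') (by linarith : 0 ≤ v + U - 4 * s ^ 2)]
    linarith
  have hI : IntegrableOn (quadExp s n γ) (Ioi U) := (integrable_quadExp hs n γ).integrableOn
  have hJ : IntegrableOn (fun v ↦ Real.exp A * Real.exp (-v)) (Ioi U) :=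
    (integrableOn_exp_neg_Ioi U).const_mul _
  calc ‖∫ v in Ioi U, quadExp s n γ v‖ ≤ ∫ v in Ioi U, ‖quadExp s n γ v‖ :=
        norm_integral_le_integral_norm _
    _ ≤ ∫ v in Ioi U, Real.exp A * Real.exp (-v) :=
        setIntegral_mono_on hI.norm hJ measurableSet_Ioi hdom
    _ = Real.exp A * Real.exp (-U) := by
        rw [MeasureTheory.integral_const_mul, integral_exp_neg_Ioi]
    _ = Real.exp (n + U - U ^ 2 / (2 * s ^ 2)) := by
        rw [← Real.exp_add, hA]; ring_nf

/-- **Lower tail**: `‖∫_{v ≤ −n} Q‖ ≤ 1` (`‖Q(v)‖ ≤ e^{n+v}`). [folklore] -/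
theorem norm_integral_quadExp_Iic_le {s : ℝ} (hs : 0 < s) (n γ : ℝ) :
    ‖∫ v in Iic (-n), quadExp s n γ v‖ ≤ 1 := by
  have hs2 : (0 : ℝ) < 2 * s ^ 2 := by positivity
  have hdom : ∀ v ∈ Iic (-n), ‖quadExp s n γ v‖ ≤ Real.exp n * Real.exp v := by
    intro v _
    rw [norm_quadExp, ← Real.exp_add, Real.exp_le_exp]
    have : 0 ≤ v ^ 2 / (2 * s ^ 2) := by positivity
    linarith
  have hI : IntegrableOn (quadExp s n γ) (Iic (-n)) := (integrable_quadExp hs n γ).integrableOn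
  have hJ : IntegrableOn (fun v ↦ Real.exp n * Real.exp v) (Iic (-n)) :=
    (integrableOn_exp_Iic (-n)).const_mul _
  calc ‖∫ v in Iic (-n), quadExp s n γ v‖ ≤ ∫ v in Iic (-n), ‖quadExp s n γ v‖ :=
        norm_integral_le_integral_norm _
    _ ≤ ∫ v in Iic (-n), Real.exp n * Real.exp v :=
        setIntegral_mono_on hI.norm hJ measurableSet_Iic hdom
    _ = Real.exp n * Real.exp (-n) := by
        rw [MeasureTheory.integral_const_mul, integral_exp_Iic]
    _ = 1 := by rw [← Real.exp_add, add_neg_cancel, Real.exp_zero]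

/-- Splitting off the tails: `∫_{−n}^{U} Q = ∫_ℝ Q − ∫_{v > U} Q − ∫_{v ≤ −n} Q`. [folklore] -/
theorem integral_quadExp_interval_eq {s : ℝ} (hs : 0 < s) (n γ U : ℝ) :
    ∫ v in (-n)..U, quadExp s n γ v =
      (∫ v, quadExp s n γ v) - (∫ v in Ioi U, quadExp s n γ v) - ∫ v in Iic (-n), quadExp s n γ v := by
  have hI := integrable_quadExp hs n γ
  rw [← intervalIntegral.integral_Iic_sub_Iic hI.integrableOn hI.integrableOn,
    ← intervalIntegral.integral_Iic_add_Ioi (b := U) hI.integrableOn hI.integrableOn]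
  ring

/-! ## Assembly: the two-sided estimate for the Gaussian Dirichlet polynomial -/

/-- `√(π/(2s²)⁻¹) = √(2π s²)` and `s⁻¹ √(π/(4s²)⁻¹) = 2√π`: bookkeeping of the Gaussian constants,
in the form `|γ| √(π/(2s²)⁻¹) + s⁻¹ √(π/(4s²)⁻¹) = |γ| √(2π s²) + 2 √π`. [folklore] -/
theorem gaussConst_eq {s : ℝ} (hs : 0 < s) (γ : ℝ) :
    |γ| * Real.sqrt (π / (2 * s ^ 2)⁻¹) + s⁻¹ * Real.sqrt (π / (4 * s ^ 2)⁻¹) =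
      |γ| * Real.sqrt (2 * π * s ^ 2) + 2 * Real.sqrt π := by
  have h1 : π / (2 * s ^ 2)⁻¹ = 2 * π * s ^ 2 := by rw [div_inv_eq_mul]; ring
  have h2 : π / (4 * s ^ 2)⁻¹ = π * (2 * s) ^ 2 := by rw [div_inv_eq_mul]; ring
  rw [h1, h2, Real.sqrt_mul Real.pi_pos.le, Real.sqrt_sq (by positivity)]
  field_simp

/-- **Engine, upper bound.** For `s > 0`, a natural `M ≥ 1` with `U := log M − n ≥ 2s²` and any
real `γ`:
`‖∑_{m=2}^{M} g(log m − n) m^{iγ}‖ ≤ √(2πs²) e^{n + (1−γ²)s²/2} + e^{n + U − U²/(2s²)} + 1 + |γ|√(2πs²) + 2√π`,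
`g(v) = exp(−v²/(2s²))`. [folklore] -/
theorem norm_sum_gauss_cpow_le {s : ℝ} (hs : 0 < s) (n γ : ℝ) {M : ℕ} (hM : 1 ≤ M)
    (hU : 2 * s ^ 2 ≤ Real.log M - n) :
    ‖∑ m ∈ Finset.Icc 2 M, ((Real.exp (-((Real.log m - n) ^ 2 / (2 * s ^ 2))) : ℝ) : ℂ) *
        (m : ℂ) ^ (((γ : ℝ) : ℂ) * I)‖ ≤
      Real.sqrt (2 * π * s ^ 2) * Real.exp (n + (1 - γ ^ 2) * s ^ 2 / 2) +
        Real.exp (n + (Real.log M - n) - (Real.log M - n) ^ 2 / (2 * s ^ 2)) + 1 +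
        (|γ| * Real.sqrt (2 * π * s ^ 2) + 2 * Real.sqrt π) := by
  have hM' : (1 : ℝ) ≤ M := by exact_mod_cast hM
  -- the sum is `∑ G(log m)`
  have hsum : ∑ m ∈ Finset.Icc 2 M, ((Real.exp (-((Real.log m - n) ^ 2 / (2 * s ^ 2))) : ℝ) : ℂ) *
      (m : ℂ) ^ (((γ : ℝ) : ℂ) * I) = ∑ m ∈ Finset.Icc 2 M, gaussPhase s n γ (Real.log (m : ℝ)) := by
    refine Finset.sum_congr rfl fun m hm ↦ ?_
    rw [Finset.mem_Icc] at hm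
    rw [gaussPhase_log_natCast s n γ (by omega)]
  -- Euler–Maclaurin
  have hEM := norm_sum_sub_integral_le (F := fun x ↦ gaussPhase s n γ (Real.log x))
    (F' := fun x ↦ x⁻¹ • (gaussPhase s n γ (Real.log x) * phaseExpDeriv s n γ (Real.log x)))
    (fun x hx ↦ hasDerivAt_gaussPhase_log s n γ (by linarith)) ?_ M hM
  swap
  · refine ContinuousOn.smul (continuousOn_inv₀.mono fun x hx ↦ ?_) ?_
    · rw [mem_compl_iff, mem_singleton_iff]; exact (lt_of_lt_of_le one_pos hx).ne'
    · refine (((continuous_gaussPhase s n γ).mul (continuous_phaseExpDeriv s n γ)).comp_continuousOn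
        (Real.continuousOn_log.mono fun x hx ↦ ?_))
      rw [mem_compl_iff, mem_singleton_iff]; exact (lt_of_lt_of_le one_pos hx).ne'
  rw [integral_norm_deriv_eq s n γ hM', integral_gaussPhase_log_eq s n γ hM',
    integral_quadExp_interval_eq hs] at hEM
  have hD := (integral_norm_deriv_le hs n γ hM').trans_eq (gaussConst_eq hs γ)
  have h1 := norm_integral_quadExp hs n γ
  have h2 := norm_integral_quadExp_Ioi_le hs n γ hU
  have h3 := norm_integral_quadExp_Iic_le hs n γ
  rw [hsum]
  -- `‖S‖ ≤ ‖I‖ + ‖S - I‖`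
  have htri : ∀ (S I₀ I₁ I₂ : ℂ), ‖S‖ ≤ ‖I₀‖ + ‖I₁‖ + ‖I₂‖ + ‖S - (I₀ - I₁ - I₂)‖ := by
    intro S I₀ I₁ I₂
    calc ‖S‖ = ‖(I₀ - I₁ - I₂) + (S - (I₀ - I₁ - I₂))‖ := by ring_nf
      _ ≤ ‖I₀ - I₁ - I₂‖ + ‖S - (I₀ - I₁ - I₂)‖ := norm_add_le _ _
      _ ≤ ‖I₀‖ + ‖I₁‖ + ‖I₂‖ + ‖S - (I₀ - I₁ - I₂)‖ := by
          have := norm_sub_le (I₀ - I₁) I₂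
          have := norm_sub_le I₀ I₁
          linarith
  refine (htri _ (∫ v, quadExp s n γ v) (∫ v in Ioi (Real.log M - n), quadExp s n γ v)
    (∫ v in Iic (-n), quadExp s n γ v)).trans ?_
  rw [h1]
  linarith

/-- **Engine, lower bound** (`γ = 0`): for `s > 0`, a natural `M ≥ 1` with `U := log M − n ≥ 2s²`,
`∑_{m=2}^{M} g(log m − n) ≥ √(2πs²) e^{n + s²/2} − e^{n + U − U²/(2s²)} − 1 − 2√π`. [folklore] -/
theorem sum_gauss_ge {s : ℝ} (hs : 0 < s) (n : ℝ) {M : ℕ} (hM : 1 ≤ M)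
    (hU : 2 * s ^ 2 ≤ Real.log M - n) :
    Real.sqrt (2 * π * s ^ 2) * Real.exp (n + s ^ 2 / 2) -
        Real.exp (n + (Real.log M - n) - (Real.log M - n) ^ 2 / (2 * s ^ 2)) - 1 - 2 * Real.sqrt π ≤
      ∑ m ∈ Finset.Icc 2 M, Real.exp (-((Real.log m - n) ^ 2 / (2 * s ^ 2))) := by
  have hM' : (1 : ℝ) ≤ M := by exact_mod_cast hM
  have hsum : ((∑ m ∈ Finset.Icc 2 M, Real.exp (-((Real.log m - n) ^ 2 / (2 * s ^ 2))) : ℝ) : ℂ) =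
      ∑ m ∈ Finset.Icc 2 M, gaussPhase s n 0 (Real.log (m : ℝ)) := by
    push_cast
    refine Finset.sum_congr rfl fun m hm ↦ ?_
    rw [Finset.mem_Icc] at hm
    rw [gaussPhase_log_natCast s n 0 (by omega)]
    simp
  have hEM := norm_sum_sub_integral_le (F := fun x ↦ gaussPhase s n 0 (Real.log x))
    (F' := fun x ↦ x⁻¹ • (gaussPhase s n 0 (Real.log x) * phaseExpDeriv s n 0 (Real.log x)))
    (fun x hx ↦ hasDerivAt_gaussPhase_log s n 0 (by linarith)) ?_ M hM
  swap
  · refine ContinuousOn.smul (continuousOn_inv₀.mono fun x hx ↦ ?_) ?_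
    · rw [mem_compl_iff, mem_singleton_iff]; exact (lt_of_lt_of_le one_pos hx).ne'
    · refine (((continuous_gaussPhase s n 0).mul (continuous_phaseExpDeriv s n 0)).comp_continuousOn
        (Real.continuousOn_log.mono fun x hx ↦ ?_))
      rw [mem_compl_iff, mem_singleton_iff]; exact (lt_of_lt_of_le one_pos hx).ne'
  rw [integral_norm_deriv_eq s n 0 hM', integral_gaussPhase_log_eq s n 0 hM',
    integral_quadExp_interval_eq hs, ← hsum] at hEM
  have hD := (integral_norm_deriv_le hs n 0 hM').trans_eq (gaussConst_eq hs 0)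
  rw [abs_zero, zero_mul, zero_add] at hD
  have h1 := norm_integral_quadExp hs n 0
  have h2 := norm_integral_quadExp_Ioi_le hs n 0 hU
  have h3 := norm_integral_quadExp_Iic_le hs n 0
  have e0 : n + (1 - (0 : ℝ) ^ 2) * s ^ 2 / 2 = n + s ^ 2 / 2 := by ring
  rw [e0] at h1
  -- `‖S‖ ≥ ‖I₀‖ - ‖I₁‖ - ‖I₂‖ - ‖S - (I₀ - I₁ - I₂)‖`
  have htri : ∀ (S I₀ I₁ I₂ : ℂ), ‖I₀‖ - ‖I₁‖ - ‖I₂‖ - ‖S - (I₀ - I₁ - I₂)‖ ≤ ‖S‖ := by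
    intro S I₀ I₁ I₂
    have h : ‖I₀‖ ≤ ‖S‖ + ‖I₁‖ + ‖I₂‖ + ‖S - (I₀ - I₁ - I₂)‖ := by
      calc ‖I₀‖ = ‖S + I₁ + I₂ - (S - (I₀ - I₁ - I₂))‖ := by ring_nf
        _ ≤ ‖S + I₁ + I₂‖ + ‖S - (I₀ - I₁ - I₂)‖ := norm_sub_le _ _
        _ ≤ ‖S‖ + ‖I₁‖ + ‖I₂‖ + ‖S - (I₀ - I₁ - I₂)‖ := by
            linarith [norm_add_le (S + I₁) I₂, norm_add_le S I₁]
    linarith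
  have hS : ‖((∑ m ∈ Finset.Icc 2 M, Real.exp (-((Real.log m - n) ^ 2 / (2 * s ^ 2))) : ℝ) : ℂ)‖ =
      ∑ m ∈ Finset.Icc 2 M, Real.exp (-((Real.log m - n) ^ 2 / (2 * s ^ 2))) := by
    rw [Complex.norm_real, Real.norm_eq_abs, abs_of_nonneg (Finset.sum_nonneg fun m _ ↦ (Real.exp_pos _).le)]
  have key := htri (((∑ m ∈ Finset.Icc 2 M, Real.exp (-((Real.log m - n) ^ 2 / (2 * s ^ 2))) : ℝ) : ℂ))
    (∫ v, quadExp s n 0 v) (∫ v in Ioi (Real.log M - n), quadExp s n 0 v)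
    (∫ v in Iic (-n), quadExp s n 0 v)
  rw [hS, h1] at key
  linarith

end Summit.RiemannHypothesis.RiemannHypothesis.Theorems.EtaLeadingQuarter.LockingEngine

end
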